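import Mathlib
import Summits.Ventures.PercRepro2.SwOutWeakCubeRow
import Summits.Ventures.PercRepro2.SwOutWeakCubeSide

/-!
# THE ROW FROM WEAK CUBES, CLASS BY CLASS: fibred blocks on some classes, whole-side blocks on the
others (blind cell PercRepro2, night-4 g38, 2026-08-29; proofs/NIGHT4-G38.md §4)

`swAll_markStep_of_junctions_weakCubes` (SwOutWeakCubeRow) asks the fibred weak-cube blocks on
EVERY class of every pattern, `swAll_markStep_of_weakCubeSide` (SwOutWeakCubeSide) the whole-side
blocks on every class; the census certifies one or the other class by class (at `n = 7`, 19 of the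
456 open pairs need cross-fibre blocks on some class — mining/night-4/g38/README.md §G′).  Since the
row is proved class by class (`card_le_g_of_classes`), the hypothesis may be chosen per class:
**`swAll_markStep_of_weakCubeClasses`**.
-/

namespace Summit.Ventures.PercRepro2

namespace LocRows

open Hull

universe u v

variable {V : Type u} {E : Type v} [Fintype E] [DecidableEq E]

open scoped Classical

variable {ends : E → Sym2 V} {l h : V} {𝓤 𝓓 𝓓'' : Set (Set V)} {X : Set V} {𝓤' : Set (Set V)}

/-- **The general doubly typed row from weak cubes, class by class**: on every class either the
fibred weak-cube blocks (for the junctions `J`) or the whole-side weak-cube blocks. -/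
theorem gTypedSwAll_of_weakCubeClasses {J : Finset V} (hlh : l ≠ h)
    (hcl : ∀ ξ, (∀ T ⊆ J, WeakCubeBlocks ends l h 𝓤 𝓓 𝓓'' X 𝓤' ({l}ᶜ) ξ fun ζ =>
        (∀ r ∈ insert h (↑(J \ T) : Set V), hull ends ζ r ⊆ ({l}ᶜ : Set V)) ∧
          (∀ u ∈ (↑T : Set V), ¬ hull ends ζ u ⊆ ({l}ᶜ : Set V))) ∨
      WeakCubeSide ends l h 𝓤 𝓓 𝓓'' X 𝓤' ({l}ᶜ) ξ) :
    GTypedSwAll ends l h 𝓤 𝓓 𝓓'' X 𝓤' :=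
  exists_swAll_injection_of_card_le h _ (card_le_g_of_classes hlh fun ξ _ h𝓔 => by
    rcases hcl ξ with hwb | hws
    · exact rigidOK_g_of_junctions_weakCubes (J := J) hwb h𝓔
    · exact rigidOK_g_of_weakCubeSide hws h𝓔)

section MarkStep

variable {x : V}

/-- **THE GENERAL MARK STEP FROM WEAK CUBES, CLASS BY CLASS**: row 2′SW-ALL with the mark `x` on
every graph when every class of every pattern of the mark's edges carries the fibred or the
whole-side weak-cube blocks. -/
theorem swAll_markStep_of_weakCubeClasses (hlh : l ≠ h) (hxl : x ≠ l) (hxh : x ≠ h)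
    {J : Finset V}
    (hcl : ∀ d : Config E, ∀ ξ, (∀ T ⊆ J, WeakCubeBlocks (isolate ends x) l h (markU ends d x)
        (markD ends d x) (markD'' ends d x) {x} Set.univ ({l}ᶜ) ξ fun ζ =>
          (∀ r ∈ insert h (↑(J \ T) : Set V), hull (isolate ends x) ζ r ⊆ ({l}ᶜ : Set V)) ∧
            (∀ u ∈ (↑T : Set V), ¬ hull (isolate ends x) ζ u ⊆ ({l}ᶜ : Set V))) ∨
      WeakCubeSide (isolate ends x) l h (markU ends d x) (markD ends d x) (markD'' ends d x) {x}
        Set.univ ({l}ᶜ) ξ) :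
    SwAll ends l h x := by
  refine swAll_of_gTyped_patterns hxl hxh fun d _ => ?_
  exact gTypedSwAll_of_weakCubeClasses (J := J) hlh (hcl d)

/-- **Row (SW) from the general mark step from weak cubes, class by class.** -/
theorem sw_markStep_of_weakCubeClasses (hlh : l ≠ h) (hxl : x ≠ l) (hxh : x ≠ h)
    {J : Finset V}
    (hcl : ∀ d : Config E, ∀ ξ, (∀ T ⊆ J, WeakCubeBlocks (isolate ends x) l h (markU ends d x)
        (markD ends d x) (markD'' ends d x) {x} Set.univ ({l}ᶜ) ξ fun ζ =>
          (∀ r ∈ insert h (↑(J \ T) : Set V), hull (isolate ends x) ζ r ⊆ ({l}ᶜ : Set V)) ∧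
            (∀ u ∈ (↑T : Set V), ¬ hull (isolate ends x) ζ u ⊆ ({l}ᶜ : Set V))) ∨
      WeakCubeSide (isolate ends x) l h (markU ends d x) (markD ends d x) (markD'' ends d x) {x}
        Set.univ ({l}ᶜ) ξ) :
    Sw ends l h x :=
  sw_of_swAll ends (swAll_markStep_of_weakCubeClasses hlh hxl hxh hcl)

end MarkStep

end LocRows

end Summit.Ventures.PercRepro2
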